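import Literature.AnabelianGeometry.EtaleTheta.ThetaCoversTemperedOfSetting
import Literature.IUT.HodgeArakelov.PlusMinusTowerCoverModelPrelims
import Literature.AnabelianGeometry.SemiGraphs.TemperedAnabelianWitness
import Mathlib.Topology.Algebra.Group.Pointwise
import HarnessLib

/-!
# [EtTh] §2 at the §1 model: the splitting of `D̄_x ↠ G_K` FROM A SECTION of `D_x ↠ G_K`
# (proof-only companion; GAP-LEDGER G-L2d3-6 reduced to print-shaped inputs)

Mochizuki, *The étale theta function and its Frobenioid-theoretic manifestations*, Publ. RIMS **45**
(2009), §2: Def. 2.1 preamble p. 35 ("`D_x ⊆ Π_X` … `1 → Δ̄_Θ → D̄_x → G_K → 1`"), Prop. 2.2 (ii) p. 37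
("the `H¹(G_K, Δ̄_Θ)`-torsor of splittings of `D̄_x ↠ G_K`"), Def. 2.3 p. 38 (printed 261–264)
[cite: MochizukiEtTh2009, Prop 2.2(ii) p.37].

Cell abc-iut, layer L2, seat abc-iut-L2-d3 (gen 5), row W3-L2-02 «§2 COVER/ORBIT MODEL» — residue
reduction. PROOF-ONLY (no `def`, no new named `Prop` fact, zero edit of anyone's file).

The first inhabitant `MuTwoSetting.CLevelData.temperedCoverData` of abc-iut-L2-t2's
`ThetaCovers.TemperedCoverData l` at the arithmetic model (ThetaCoversTemperedOfSetting, p429967) takes,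
among its hypothesis binders (GAP-LEDGER G-L2d3-6): a CLOSED SPLITTING `S` of `D̄_x ↠ G_K`
(`IsSplitting S ∧ IsClosed S`, census P-C6) and the TEMPERED normalities `hN`, `hY` (P-C7). This file
DERIVES them from print-shaped inputs:

* `ThetaSetting.PiCData.isSplitting_of_section` — generic over abc-iut-L2-t10's input bundle
  `I : D.PiCData PiC` and the cover `I.coverDataAx …` (ThetaCoversAxOfSetting): a SECTION of
  `D_x ↠ G_K` — a homomorphism `s : G_K → Π^tp_X` with values in `D_x` and `aug ∘ s = id` (print: the
  cusp `x` of `X` is `K`-rational, p. 35; exactly the datum `sect x` proposed for abc-iut-L2-t7's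
  `OncePuncturedData` v-next in G-L2d3-6, taken here as a HYPOTHESIS BINDER) — yields the splitting
  `S := incl(toHat(s(G_K))) · Ker(Δ_X ↠ Δ̄_X)`: `Ker ≤ S ≤ D_x · Ker`, `S ∩ Δ̄_Θ-preimage = Ker` (the
  augmentation kills `Δ̄_Θ ⊆ Δ_X`), `aug(S) = G_K`;
* `ThetaSetting.PiCData.isClosed_splittingOfSection` — if `s` is moreover CONTINUOUS, `S` is closed
  (`G_K = Gal(K̄/K)` is compact, so `s(G_K)` is compact; compact · closed is closed);
* `ThetaSetting.PiCData.exists_isSplitting_isClosed_of_section` — hence the binder pair (`hS`, `hSc`);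
* `MuTwoSetting.CLevelData.exists_temperedCoverData_of_section` /
  `nonempty_temperedCoverData_of_section` — at the model, with `hN`/`hY` supplied BY NAME from the
  printed definition of `Z` (`Thm16Sub.KerToZIsCompactlyGenerated` = L02 of SUBDAG-EtTh-Thm16:
  abc-iut-L6-t19's `map_inclX_GtpXu_normal`, this seat's `map_inclX_GtpY_normal`):
  `TemperedCoverData l` is INHABITED over the §1 model given {a continuous section of `D_x ↠ G_K`, L02}
  and the standing printed inputs `op` (cusps), P-C3 `hIx` (G-L2t10-3), P-C4 `hιell` (G-L2t10-4 (a)).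

HONEST FRAMING: nothing asserts that a `MuTwoSetting`, a `CLevelData` or a section exists; [EtTh] is
refereed; no side is taken on [IUTchIII] Cor. 3.12; typed ≠ proved elsewhere.
-/

namespace Literature.AnabelianGeometry.EtaleTheta

open Literature.AnabelianGeometry.SemiGraphs ThetaCovers
open _root_.Topology
open scoped Pointwise

namespace ThetaSetting.PiCData

variable {p : ℕ} [Fact p.Prime] {D : ThetaSetting p} {PiC : Type} [Group PiC] [TopologicalSpace PiC]
  [IsTopologicalGroup PiC] [T2Space PiC] (I : D.PiCData PiC) (l : ℕ)

/-- The augmentation of `Π_C` on the image of a section `s` of `D_x ↠ G_K`: `aug(incl(toHat(s σ))) = σ`.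
[cite: MochizukiEtTh2009, Def 2.1 p.35] -/
theorem aug_incl_toHat_section (s : ↥D.GK →* D.PiTemp) (hsa : ∀ σ, D.aug (s σ) = (σ : GQp p))
    (σ : ↥D.GK) : I.aug (I.incl (D.toHat (s σ))) = (σ : GQp p) := by
  rw [I.aug_incl, D.augHat_comp, hsa]

/-- **A section of `D_x ↠ G_K` gives a splitting of `D̄_x ↠ G_K`** (Prop. 2.2 (ii): the torsor of
splittings is nonempty at a `K`-rational cusp): for `s : G_K → D_x ⊆ Π^tp_X` with `aug ∘ s = id`, the
subgroup `S := incl(toHat(s(G_K))) · Ker` of `Π_C` is a splitting for the cover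
`I.coverDataAx l e hx hodd hIx hιell hιtheta` — `Ker ≤ S ≤ D_x · Ker`, `S ∩ Δ̄_Θ-preimage = Ker`,
`S ↠ G_K`. [cite: MochizukiEtTh2009, Prop 2.2(ii) p.37] -/
theorem isSplitting_of_section (e : D.OncePuncturedData) {x : D.Pt} (hx : D.IsCusp x) (hodd : Odd l)
    (hIx : (I.Dx x ⊓ I.augGK.ker) ⊔ I.barKer l = I.barTheta l)
    (hιell : ∀ c ∈ I.augGK.ker, c ∉ I.PiX → ∀ d ∈ I.PiX ⊓ I.augGK.ker, c * d * c⁻¹ * d ∈ I.barTheta l)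
    (hιtheta : ∀ c ∈ I.augGK.ker, c ∉ I.PiX → ∀ t ∈ I.barTheta l, c * t * c⁻¹ * t⁻¹ ∈ I.barKer l)
    (s : ↥D.GK →* D.PiTemp) (hs : ∀ σ, s σ ∈ D.decomp x) (hsa : ∀ σ, D.aug (s σ) = (σ : GQp p)) :
    (I.coverDataAx l e hx hodd hIx hιell hιtheta).toCoverData.IsSplitting
      ((I.incl.toMonoidHom.comp (D.toHat.toMonoidHom.comp s)).range ⊔ I.barKer l) := by
  haveI : (I.barKer l).Normal := I.barKer_normal l e
  set φ : ↥D.GK →* PiC := I.incl.toMonoidHom.comp (D.toHat.toMonoidHom.comp s) with hφ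
  have hφapp : ∀ σ, φ σ = I.incl (D.toHat (s σ)) := fun _ => rfl
  have haug1 : ∀ g ∈ I.barTheta l, I.aug g = 1 := fun g hg =>
    I.mem_ker_augGK.mp (I.barTheta_le l e hg).2
  refine
    { barKer_le := le_sup_right
      le := ?_
      inf_eq := ?_
      surj := ?_ }
  · -- `S ≤ D_x · Ker`: `s(G_K) ⊆ D_x`
    show φ.range ⊔ I.barKer l ≤ I.Dx x ⊔ I.barKer l
    refine sup_le_sup_right ?_ _
    rintro _ ⟨σ, rfl⟩
    exact ⟨D.toHat (s σ), Subgroup.le_topologicalClosure _ ⟨s σ, hs σ, rfl⟩, (hφapp σ).symm⟩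
  · -- `S ∩ Δ̄_Θ-preimage = Ker`: the augmentation kills `Δ̄_Θ`, so the `s`-component is trivial
    show (φ.range ⊔ I.barKer l) ⊓ I.barTheta l = I.barKer l
    refine le_antisymm ?_ (le_inf le_sup_right (I.barKer_le_barTheta l e))
    rintro g ⟨hgS, hgT⟩
    have hg' : g ∈ ((φ.range : Set PiC) * (I.barKer l : Set PiC)) := by
      rw [← Subgroup.mul_normal]; exact hgS
    obtain ⟨a, ⟨σ, rfl⟩, n, hn, rfl⟩ := hg'
    change φ σ * n ∈ I.barTheta l at hgT
    show φ σ * n ∈ I.barKer l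
    have hn1 : I.aug n = 1 := haug1 n (I.barKer_le_barTheta l e hn)
    have hσ : (σ : GQp p) = 1 := by
      rw [← I.aug_incl_toHat_section s hsa σ, ← hφapp]
      have h := haug1 _ hgT
      rwa [map_mul, hn1, mul_one] at h
    have hσ1 : σ = 1 := Subtype.ext hσ
    rw [hσ1, map_one, one_mul]
    exact hn
  · -- `S ↠ G_K`
    rintro (σ : ↥D.GK)
    refine ⟨⟨φ σ, Subgroup.mem_sup_left ⟨σ, rfl⟩⟩, Subtype.ext ?_⟩
    show ((I.augGK (φ σ) : D.GK) : GQp p) = (σ : GQp p)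
    rw [coe_augGK_apply, hφapp, I.aug_incl_toHat_section s hsa]

/-- **The splitting from a CONTINUOUS section is closed**: `G_K = Gal(K̄/K)` is compact (a closed subgroup
of the profinite `G_{ℚ_p}`), so `incl(toHat(s(G_K)))` is compact and `incl(toHat(s(G_K))) · Ker` is closed
(`Ker` is closed, `CoverData.isClosed_barKer`). [cite: MochizukiEtTh2009, Def 2.3 p.38] -/
theorem isClosed_splittingOfSection (e : D.OncePuncturedData) (s : ↥D.GK →* D.PiTemp)
    (hsc : Continuous s) :
    IsClosed (((I.incl.toMonoidHom.comp (D.toHat.toMonoidHom.comp s)).range ⊔ I.barKer l :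
      Subgroup PiC) : Set PiC) := by
  haveI : (I.barKer l).Normal := I.barKer_normal l e
  haveI : CompactSpace (GQp p) := (isProfiniteCompletion_id_GQp (p := p)).compactSpace
  haveI : FiniteDimensional ℚ_[p] D.K := D.finiteDimensional_K
  have hGK : IsClosed ((D.GK : Subgroup (GQp p)) : Set (GQp p)) :=
    IntermediateField.fixingSubgroup_isClosed D.K
  haveI : CompactSpace ↥D.GK := isCompact_iff_compactSpace.mp hGK.isCompact
  have hcont : Continuous (I.incl.toMonoidHom.comp (D.toHat.toMonoidHom.comp s)) :=
    (map_continuous I.incl).comp ((map_continuous D.toHat).comp hsc)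
  have hK : IsCompact ((I.incl.toMonoidHom.comp (D.toHat.toMonoidHom.comp s)).range : Set PiC) := by
    rw [MonoidHom.coe_range]
    exact isCompact_range hcont
  rw [Subgroup.mul_normal]
  exact (I.isClosed_barKer l).mul_left_of_isCompact hK

/-- **A continuous section of `D_x ↠ G_K` gives a CLOSED splitting** — the binder pair (`hS`, `hSc`) of
`MuTwoSetting.CLevelData.temperedCoverData` (census P-C6, GAP-LEDGER G-L2d3-6) derived from print's
"the cusp is `K`-rational". [cite: MochizukiEtTh2009, Prop 2.2(ii) p.37] -/
theorem exists_isSplitting_isClosed_of_section (e : D.OncePuncturedData) {x : D.Pt} (hx : D.IsCusp x)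
    (hodd : Odd l) (hIx : (I.Dx x ⊓ I.augGK.ker) ⊔ I.barKer l = I.barTheta l)
    (hιell : ∀ c ∈ I.augGK.ker, c ∉ I.PiX → ∀ d ∈ I.PiX ⊓ I.augGK.ker, c * d * c⁻¹ * d ∈ I.barTheta l)
    (hιtheta : ∀ c ∈ I.augGK.ker, c ∉ I.PiX → ∀ t ∈ I.barTheta l, c * t * c⁻¹ * t⁻¹ ∈ I.barKer l)
    (s : ↥D.GK →* D.PiTemp) (hs : ∀ σ, s σ ∈ D.decomp x) (hsa : ∀ σ, D.aug (s σ) = (σ : GQp p))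
    (hsc : Continuous s) :
    ∃ S : Subgroup PiC, (I.coverDataAx l e hx hodd hIx hιell hιtheta).toCoverData.IsSplitting S ∧
      IsClosed (S : Set PiC) :=
  ⟨_, I.isSplitting_of_section l e hx hodd hIx hιell hιtheta s hs hsa,
    I.isClosed_splittingOfSection l e s hsc⟩

end ThetaSetting.PiCData

/-! ### At the model: `TemperedCoverData` from a continuous section and L02 -/

namespace MuTwoSetting.CLevelData

variable {p : ℕ} [Fact p.Prime] {M : MuTwoSetting p}
variable {PC : Type} [Group PC] [TopologicalSpace PC] [IsTopologicalGroup PC] [T2Space PC]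

/-- **`TemperedCoverData` at the model from print-shaped inputs** (over any injective profinite
completion `ιC` of `Π^tp_C`): the assembly `temperedCoverData` fed with `hN`, `hY` from the printed
definition of `Z` (L02, `Thm16Sub.KerToZIsCompactlyGenerated`) and with the closed splitting of a
continuous section `s` of `D_x ↠ G_K`; the resulting cover has abc-iut-L2-t10's `PiCData.coverDataAx`
as profinite part. [cite: MochizukiEtTh2009, Def 2.3 p.38] -/
theorem exists_temperedCoverData_of_section (e : M.CLevelData) (ιC : M.GtpC →ₜ* PC)
    (hιC : IsProfiniteCompletion ιC) (hinj : Function.Injective ιC)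
    (op : M.toThetaSetting.OncePuncturedData) {l : ℕ} (hodd : Odd l) {x : M.Pt} (hx : M.IsCusp x)
    (hIx : ((e.piCDataOf ιC hιC).Dx x ⊓ (e.piCDataOf ιC hιC).augGK.ker) ⊔ (e.piCDataOf ιC hιC).barKer l =
      (e.piCDataOf ιC hιC).barTheta l)
    (hιell : ∀ c ∈ (e.piCDataOf ιC hιC).augGK.ker, c ∉ (e.piCDataOf ιC hιC).PiX →
      ∀ d ∈ (e.piCDataOf ιC hιC).PiX ⊓ (e.piCDataOf ιC hιC).augGK.ker,
        c * d * c⁻¹ * d ∈ (e.piCDataOf ιC hιC).barTheta l)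
    (h02 : Thm16Sub.KerToZIsCompactlyGenerated M.toThetaSetting)
    (s : ↥M.GK →* M.PiTemp) (hs : ∀ σ, s σ ∈ M.decomp x) (hsa : ∀ σ, M.aug (s σ) = (σ : GQp p))
    (hsc : Continuous s) :
    ∃ T : TemperedCoverData.{0} l,
      T.toCoverDataAx = (e.piCDataOf ιC hιC).coverDataAx l op hx hodd hIx hιell
        ((e.piCDataOf ιC hιC).inv_theta_of_inv_ell l op hιell) :=
  ⟨e.temperedCoverData ιC hιC hinj op hodd hx hIx hιell (e.map_inclX_GtpXu_normal l h02)
      (e.map_inclX_GtpY_normal h02)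
      ((e.piCDataOf ιC hιC).isSplitting_of_section l op hx hodd hIx hιell _ s hs hsa)
      ((e.piCDataOf ιC hιC).isClosed_splittingOfSection l op s hsc),
    e.temperedCoverData_toCoverDataAx ιC hιC hinj op hodd hx hIx hιell _ _ _ _⟩

/-- **`ThetaCovers.TemperedCoverData l` is INHABITED over the [EtTh] §1 model** `(M, e)` (`C = X/±1` at
the C-level, `Π_C :=` THE profinite completion `e.toPiCHat` of `Π^tp_C`), given: the cusp datum `op`,
the printed inputs P-C3 `hIx` ("`I_x ⥲ Δ̄_Θ`") and P-C4 `hιell` ("`ι` acts by `−1` on `Δ̄^ell_X`"), the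
printed definition of `Z` (L02), and a continuous section of `D_x ↠ G_K` (the `K`-rational cusp).
[cite: MochizukiEtTh2009, Def 2.3 p.38] -/
theorem nonempty_temperedCoverData_of_section (e : M.CLevelData)
    (op : M.toThetaSetting.OncePuncturedData) {l : ℕ} (hodd : Odd l) {x : M.Pt} (hx : M.IsCusp x)
    (hIx : (e.piCData.Dx x ⊓ e.piCData.augGK.ker) ⊔ e.piCData.barKer l = e.piCData.barTheta l)
    (hιell : ∀ c ∈ e.piCData.augGK.ker, c ∉ e.piCData.PiX →
      ∀ d ∈ e.piCData.PiX ⊓ e.piCData.augGK.ker, c * d * c⁻¹ * d ∈ e.piCData.barTheta l)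
    (h02 : Thm16Sub.KerToZIsCompactlyGenerated M.toThetaSetting)
    (s : ↥M.GK →* M.PiTemp) (hs : ∀ σ, s σ ∈ M.decomp x) (hsa : ∀ σ, M.aug (s σ) = (σ : GQp p))
    (hsc : Continuous s) : Nonempty (TemperedCoverData.{0} l) := by
  obtain ⟨T, -⟩ := e.exists_temperedCoverData_of_section e.toPiCHat e.isProfiniteCompletion_toPiCHat
    e.toPiCHat_injective op hodd hx hIx hιell h02 s hs hsa hsc
  exact ⟨T⟩

end MuTwoSetting.CLevelData

end Literature.AnabelianGeometry.EtaleTheta
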